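import Summits.Ventures.PercRepro.Night2FatDegSide

/-!
# night-2: the DOUBLY degenerate two-planes regime — the three lines and the loads

When the points `A` of `π₂` off the spine AND the points `M` of `π₃` off the spine are both collinear, `H₀` is the
union of three lines: the spine `clF R₁`, `clF A` and `clF M`.
* **`subset_line_of_three_lines`**: every rank-2 set of `≥ 3` points of `V` lies in the spine or in the closure of one
  side (no degeneracy needed: two points off the spine in one plane span the side's closure);
* **`loaded_target_dd_dichotomy`**: a loaded target `T ∋ x` above a lossy basis pair carries a line `R` inside one of the
  three lines with the distance-1 data (two basis points on `R`, `R` NOT a class line, `rk (G ∖ T) ≥ 3`, `Y ⊆ R`) or the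
  distance-2 data (`R` a class line, `|R| = |Y| + 1`); a distance-2 line off the spine forces `rk (A ∪ M) ≤ 3` (its
  source's planes are the plane of its own side and a plane through the other side: `source_planes_of_line_off_spine`).
Paper `proofs/NIGHT-2-g35.md` §7.
-/

namespace PercRepro.Shadow

open PercRepro.ThmH PercRepro.PerFlat

variable {α : Type*} [DecidableEq α] {M : Matroid α} [M.Finite] {G : Finset α}

/-- **A rank-2 set of `≥ 3` points of `V` lies in one of the three lines** (doubly degenerate regime). -/
theorem subset_line_of_three_lines (hs : ∀ e ∈ gr M, ∀ f ∈ gr M, e ≠ f → rkN M {e, f} = 2)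
    {V : Finset α} (hVg : V ⊆ gr M) {R₁ : Finset α} {c₂ c₃ : α}
    (hcover : ∀ e ∈ V, e ∈ clF M (insert c₂ R₁) ∨ e ∈ clF M (insert c₃ R₁))
    {R : Finset α} (hRV : R ⊆ V) (hR2 : rkN M R = 2) (hR3 : 3 ≤ R.card) :
    R ⊆ clF M R₁ ∨ R ⊆ clF M (V.filter (fun e => e ∈ clF M (insert c₂ R₁) ∧ e ∉ clF M R₁)) ∨
      R ⊆ clF M (V.filter (fun e => e ∈ clF M (insert c₃ R₁) ∧ e ∉ clF M R₁)) := by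
  have hRg : R ⊆ gr M := hRV.trans hVg
  have hRcover : ∀ e ∈ R, e ∈ clF M (insert c₂ R₁) ∨ e ∈ clF M (insert c₃ R₁) := fun e he => hcover e (hRV he)
  -- inside a plane `π = clF (insert c R₁)`: either in the spine or in the side line of that plane
  have key : ∀ c : α, R ⊆ clF M (insert c R₁) →
      R ⊆ clF M R₁ ∨ R ⊆ clF M (V.filter (fun e => e ∈ clF M (insert c R₁) ∧ e ∉ clF M R₁)) := by
    intro c hRπ
    by_cases hRL : R ⊆ clF M R₁
    · exact Or.inl hRL
    · right
      have hMg : V.filter (fun e => e ∈ clF M (insert c R₁) ∧ e ∉ clF M R₁) ⊆ gr M :=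
        (Finset.filter_subset _ _).trans hVg
      -- at most one point of `R` on the spine would leave two points off it; two points on the spine put `R` in it
      have hL1 : (R.filter (fun e => e ∈ clF M R₁)).card ≤ 1 := by
        rw [Finset.card_le_one]
        intro a ha b hb
        by_contra hab
        rw [Finset.mem_filter] at ha hb
        apply hRL
        exact subset_clF_of_rkN_le_two_of_two_mem hs hRg hR2.le ha.1 hb.1 hab ha.2 hb.2
      have hsplit := Finset.card_filter_add_card_filter_not (s := R) (fun e => e ∈ clF M R₁)
      have h2 : 1 < (R.filter (fun e => ¬ e ∈ clF M R₁)).card := by omega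
      obtain ⟨a, ha, b, hb, hab⟩ := Finset.one_lt_card.1 h2
      rw [Finset.mem_filter] at ha hb
      have haM : a ∈ V.filter (fun e => e ∈ clF M (insert c R₁) ∧ e ∉ clF M R₁) :=
        Finset.mem_filter.2 ⟨hRV ha.1, hRπ ha.1, ha.2⟩
      have hbM : b ∈ V.filter (fun e => e ∈ clF M (insert c R₁) ∧ e ∉ clF M R₁) :=
        Finset.mem_filter.2 ⟨hRV hb.1, hRπ hb.1, hb.2⟩
      exact subset_clF_of_rkN_le_two_of_two_mem hs hRg hR2.le ha.1 hb.1 hab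
        (subset_clF_of_subset_gr hMg haM) (subset_clF_of_subset_gr hMg hbM)
  rcases subset_plane_of_rkN_le_two_of_cover hs hRg hR2.le hR3 hRcover with h2 | h3
  · rcases key c₂ h2 with h | h
    · exact Or.inl h
    · exact Or.inr (Or.inl h)
  · rcases key c₃ h3 with h | h
    · exact Or.inl h
    · exact Or.inr (Or.inr h)

/-- **The loads of the doubly degenerate regime**: a loaded target carries a line inside one of the three lines; a
distance-2 line off the spine forces the two side lines to be coplanar (`rk (A ∪ M) ≤ 3`). -/
theorem loaded_target_dd_dichotomy (hG : G ∈ flatsQ M (5 + 1)) (hd : (gr M \ G).card = 2)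
    (hk : kColoops M G = 1) (hs : ∀ e ∈ gr M, ∀ f ∈ gr M, e ≠ f → rkN M {e, f} = 2)
    (hl : ∀ e ∈ gr M, M.Indep {e}) (hfat : (fatClosures M 5 G 2).card ≤ 1) {B₀ : Finset α}
    (hB₀ : B₀ ∈ thinMembers M 5 G) {w₀ x : α} (hD : G \ clF M B₀ = {w₀, x}) (hne : w₀ ≠ x) {R₁ : Finset α}
    (hR₁V : R₁ ⊆ (G \ coloops M G) \ {w₀, x}) (hR₁2 : rkN M R₁ = 2) (hR₁3 : 3 ≤ R₁.card) {c₂ c₃ : α}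
    (hc₂V : c₂ ∈ (G \ coloops M G) \ {w₀, x}) (hc₃V : c₃ ∈ (G \ coloops M G) \ {w₀, x})
    (hc₂ : c₂ ∉ clF M R₁) (hc₃ : c₃ ∉ clF M (insert c₂ R₁))
    (hcover : ∀ e ∈ (G \ coloops M G) \ {w₀, x}, e ∈ clF M (insert c₂ R₁) ∨ e ∈ clF M (insert c₃ R₁))
    (hdeg₂ : rkN M (((G \ coloops M G) \ {w₀, x}).filter
      (fun e => e ∈ clF M (insert c₂ R₁) ∧ e ∉ clF M R₁)) ≤ 2)
    (hdeg₃ : rkN M (((G \ coloops M G) \ {w₀, x}).filter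
      (fun e => e ∈ clF M (insert c₃ R₁) ∧ e ∉ clF M R₁)) ≤ 2)
    {T : Finset α} (hTG : T ⊆ G) (hw₀T : w₀ ∈ T) (hxT : x ∈ T)
    (hload : dload M 5 G (bigP M G) (dshGT2 M 5 G) T ≠ 0) :
    ∃ R ⊆ (T \ coloops M G) \ {w₀, x}, rkN M R = 2 ∧ 3 ≤ R.card ∧
      (R ⊆ clF M R₁ ∨
        R ⊆ clF M (((G \ coloops M G) \ {w₀, x}).filter (fun e => e ∈ clF M (insert c₂ R₁) ∧ e ∉ clF M R₁)) ∨
        R ⊆ clF M (((G \ coloops M G) \ {w₀, x}).filter (fun e => e ∈ clF M (insert c₃ R₁) ∧ e ∉ clF M R₁))) ∧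
      ((R.card + 4 = (T \ coloops M G).card ∧ 3 ≤ rkN M (G \ T) ∧ 4 ≤ rkN M (insert w₀ (insert x R))) ∨
        (R.card + 5 = (T \ coloops M G).card ∧ rkN M (insert w₀ (insert x R)) ≤ 3 ∧
          (R ⊆ clF M R₁ ∨
            rkN M (((G \ coloops M G) \ {w₀, x}).filter (fun e => e ∈ clF M (insert c₂ R₁) ∧ e ∉ clF M R₁) ∪
              ((G \ coloops M G) \ {w₀, x}).filter (fun e => e ∈ clF M (insert c₃ R₁) ∧ e ∉ clF M R₁)) ≤ 3))) := by
  have hGg : G ⊆ gr M := (mem_flatsQ.1 hG).1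
  set V := (G \ coloops M G) \ {w₀, x} with hV
  have hVg : V ⊆ gr M := fun e he => hGg (Finset.mem_sdiff.1 (Finset.mem_sdiff.1 he).1).1
  set Aset := V.filter (fun e => e ∈ clF M (insert c₂ R₁) ∧ e ∉ clF M R₁) with hAset
  set Mset := V.filter (fun e => e ∈ clF M (insert c₃ R₁) ∧ e ∉ clF M R₁) with hMset
  have hAg : Aset ⊆ gr M := (Finset.filter_subset _ _).trans hVg
  have hMg : Mset ⊆ gr M := (Finset.filter_subset _ _).trans hVg
  have hR₁g : R₁ ⊆ gr M := hR₁V.trans hVg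
  have hc₂g : c₂ ∈ gr M := hVg hc₂V
  have hc₃g : c₃ ∈ gr M := hVg hc₃V
  have hc₃L : c₃ ∉ clF M R₁ := fun h => hc₃ (clF_mono (Finset.subset_insert _ _) h)
  have hc₂π₃ : c₂ ∉ clF M (insert c₃ R₁) := notMem_clF_insert_of_notMem_clF_insert hR₁g hc₂g hc₃g hc₂ hc₃
  obtain ⟨R, hR, hR2, hR3, hcase⟩ :=
    loaded_fat_target_dichotomy_full hG hd hk hs hl hfat hB₀ hD hne hTG hw₀T hxT hload
  have hRV : R ⊆ V := fun r hr =>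
    Finset.sdiff_subset_sdiff (Finset.sdiff_subset_sdiff hTG (Finset.Subset.refl _)) (Finset.Subset.refl _) (hR hr)
  have hRg : R ⊆ gr M := hRV.trans hVg
  have hline := subset_line_of_three_lines hs hVg hcover hRV hR2 hR3
  refine ⟨R, hR, hR2, hR3, hline, ?_⟩
  rcases hcase with ⟨hRc, hGT, hRncls⟩ | ⟨hRc, hRcls, c₂', hc₂'T, c₃', hc₃'T, hc₂', hc₃', hcover'⟩
  · exact Or.inl ⟨hRc, hGT, hRncls⟩
  · right
    refine ⟨hRc, hRcls, ?_⟩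
    by_cases hRL : R ⊆ clF M R₁
    · exact Or.inl hRL
    · right
      have hc₂'g : c₂' ∈ gr M := hGg (hTG (Finset.mem_sdiff.1 (Finset.mem_sdiff.1 hc₂'T).1).1)
      have hc₃'g : c₃' ∈ gr M := hGg (hTG (Finset.mem_sdiff.1 (Finset.mem_sdiff.1 hc₃'T).1).1)
      obtain ⟨r, hrR, hrL⟩ : ∃ r ∈ R, r ∉ clF M R₁ := by
        by_contra h
        push Not at h
        exact hRL h
      -- `clF R` is the line of the side containing `r`; coplanarity of the two sides
      have hAM : ∀ e ∈ Aset, e ∉ clF M (insert c₃ R₁) := by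
        intro e he h'
        have he' := (Finset.mem_filter.1 he).2
        exact he'.2 (mem_clF_of_mem_two_planes hR₁g hc₂g hc₃g hc₂ hc₃ he'.1 h')
      have hMA : ∀ e ∈ Mset, e ∉ clF M (insert c₂ R₁) := by
        intro e he h'
        have he' := (Finset.mem_filter.1 he).2
        exact he'.2 (mem_clF_of_mem_two_planes hR₁g hc₂g hc₃g hc₂ hc₃ h' he'.1)
      rcases hline with h | hRA | hRM
      · exact absurd h hRL
      · -- `R ⊆ clF A`, off the spine: its source's planes are `π₂` and a plane through `M`
        have hRπ₂ : R ⊆ clF M (insert c₂ R₁) := by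
          have hAπ : Aset ⊆ clF M (insert c₂ R₁) := fun e he => (Finset.mem_filter.1 he).2.1
          exact hRA.trans (clF_subset_clF_of_subset_clF hAπ)
        have hRM' := source_planes_of_line_off_spine hs hR₁g hR₁2 hR₁3 hc₂g hc₂ hRg hR2 hRπ₂ hrR hrL hc₂'g hc₃'g
          hc₂' hc₃' hMA (fun e he => hcover' e (Finset.mem_filter.1 he).1) (fun e he => hcover' e (hR₁V he))
        -- `A ⊆ clF R`: `R ⊆ clF A` with `rk R = 2 ≥ rk A`
        have hcl : clF M R = clF M Aset :=
          clF_eq_clF_of_subset_clF_of_rkN_le hAg hRA (by omega)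
        have hsub : Aset ∪ Mset ⊆ clF M (R ∪ Mset) := by
          intro e he
          rw [Finset.mem_union] at he
          rcases he with he | he
          · have : e ∈ clF M R := by rw [hcl]; exact subset_clF_of_subset_gr hAg he
            exact clF_mono Finset.subset_union_left this
          · exact subset_clF_of_subset_gr (Finset.union_subset hRg hMg) (Finset.mem_union_right _ he)
        have := rkN_mono (M := M) hsub
        rw [rkN_clF] at this
        omega
      · -- `R ⊆ clF M`, off the spine: symmetric
        have hRπ₃ : R ⊆ clF M (insert c₃ R₁) := by
          have hMπ : Mset ⊆ clF M (insert c₃ R₁) := fun e he => (Finset.mem_filter.1 he).2.1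
          exact hRM.trans (clF_subset_clF_of_subset_clF hMπ)
        have hRA' := source_planes_of_line_off_spine hs hR₁g hR₁2 hR₁3 hc₃g hc₃L hRg hR2 hRπ₃ hrR hrL hc₂'g hc₃'g
          hc₂' hc₃' hAM (fun e he => hcover' e (Finset.mem_filter.1 he).1) (fun e he => hcover' e (hR₁V he))
        have hcl : clF M R = clF M Mset :=
          clF_eq_clF_of_subset_clF_of_rkN_le hMg hRM (by omega)
        have hsub : Aset ∪ Mset ⊆ clF M (R ∪ Aset) := by
          intro e he
          rw [Finset.mem_union] at he
          rcases he with he | he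
          · exact subset_clF_of_subset_gr (Finset.union_subset hRg hAg) (Finset.mem_union_right _ he)
          · have : e ∈ clF M R := by rw [hcl]; exact subset_clF_of_subset_gr hMg he
            exact clF_mono Finset.subset_union_left this
        have := rkN_mono (M := M) hsub
        rw [rkN_clF] at this
        omega

end PercRepro.Shadow
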